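import Literature.Probability.RandomPlanarGeometry.HexParafermionProofs
import HarnessLib

/-!
# Route `SAWDevelopingMap`, item `PotentialExists` (stmt-CriticalPhenomena-8299) — topological input

Helper file 1/4 for the potential lemma `F = dH` of the route `SAWDevelopingMap`
(`Summits/CriticalPhenomena/SAWScalingLimit/Theses/SAWDevelopingMap.lean`, decl `PotentialExists`).

The potential `H` lives on the vertices of the triangular lattice `𝕋` (`Site 2`), i.e. on the
faces (hexagons) of the honeycomb lattice `ℍ`; the increment of `H` along a `𝕋`-edge `{s, t}` is
prescribed by the value of the observable on the dual mid-edge `{f, g}` of `ℍ`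
(`hexFaceVertices f ∩ hexFaceVertices g = {s, t}`).  Exactness of the prescribed increments on a
simply connected domain `Λ` ("connected complement", `hexDomainSimplyConnected`) is proved in the
sibling files `SAWDevelopingMapPotentialExists{Extension,Poincare}.lean` by induction on `|Λ|`; the one global (Jordan curve
type) input it needs is proved here from the winding-number calculus of `HexSAWWinding.lean`
(coordinate model `HV` of `ℍ`, faces of `ℍ` = points of `ℤ²`):

* `leftFace_rightFace`: for adjacent faces `f ∼ g` of `𝕋` sharing the `𝕋`-edge `{s, t}`, the
  two hexagons on the two sides of the dart `f → g` of `ℍ` are (the coordinates of) `s` and `t`;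
* **`not_reflTransGen_of_two_outer_nbrs`**: if `v ∈ Λ` has two distinct neighbours `w, w' ∉ Λ`
  and `{s, t}` is the `𝕋`-edge between `v` and `w`, then `s` and `t` are NOT joined by a chain of
  `𝕋`-vertices in which consecutive ones lie on a common face of `Λ ∖ {v}`.  Proof: a path from
  `w` to `w'` in the complement of `Λ` closes up through `v` to a simple cycle `l` of `ℍ`; its
  winding number `wnd l` is constant along the chain (no flux through edges of faces off the
  cycle, `HV.wnd_left_sub_right`), but jumps by `1` across the dart `v → w` of the cycle
  (`HV.IsCyc.flux_eq_one`).

No new definitions; every declaration is proved.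
-/

noncomputable section

namespace Summit.CriticalPhenomena.SAWScalingLimit.Theorems.PotentialExists

open Finset Literature.Probability.LatticeModels Literature.Probability.RandomPlanarGeometry.SAW

/-! ### The shared edge of two adjacent faces of `𝕋` -/

/-- The up face `(x, 0)` and the down face `(x, 1)` share exactly the vertices `x + e₀`,
`x + e₁`. [folklore] -/
theorem mem_inter_up_down {x s : Site 2} (hs : s ∈ hexFaceVertices (x, 0))
    (hs' : s ∈ hexFaceVertices (x, 1)) : s = x + Pi.single 0 1 ∨ s = x + Pi.single 1 1 := by
  rw [mem_hexFaceVertices_zero] at hs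
  rw [mem_hexFaceVertices_one] at hs'
  simp only [site_two_eq_iff, Pi.add_apply, Pi.single_apply] at hs hs' ⊢
  simp at hs hs' ⊢
  omega

/-- The up face `(x, 0)` and the down face `(x - e₀, 1)` share exactly the vertices `x`,
`x + e₁`. [folklore] -/
theorem mem_inter_up_left {x s : Site 2} (hs : s ∈ hexFaceVertices (x, 0))
    (hs' : s ∈ hexFaceVertices (x - Pi.single 0 1, 1)) : s = x ∨ s = x + Pi.single 1 1 := by
  rw [mem_hexFaceVertices_zero] at hs
  rw [mem_hexFaceVertices_one] at hs'
  simp only [site_two_eq_iff, Pi.add_apply, Pi.sub_apply, Pi.single_apply] at hs hs' ⊢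
  simp at hs hs' ⊢
  omega

/-- The up face `(x, 0)` and the down face `(x - e₁, 1)` share exactly the vertices `x`,
`x + e₀`. [folklore] -/
theorem mem_inter_up_bottom {x s : Site 2} (hs : s ∈ hexFaceVertices (x, 0))
    (hs' : s ∈ hexFaceVertices (x - Pi.single 1 1, 1)) : s = x ∨ s = x + Pi.single 0 1 := by
  rw [mem_hexFaceVertices_zero] at hs
  rw [mem_hexFaceVertices_one] at hs'
  simp only [site_two_eq_iff, Pi.add_apply, Pi.sub_apply, Pi.single_apply] at hs hs' ⊢
  simp at hs hs' ⊢
  omega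

/-- **The two hexagons at a dual dart, up face first.** For an up face `(x, 0)` adjacent to the
down face `(y, 1)` and the two (distinct) common vertices `s`, `t` of the two triangles, the faces
of `ℍ` to the left and to the right of the dart `(x,0) → (y,1)` in the coordinate model `HV` are
the hexagons centred at `s` and `t`, in some order. [folklore] -/
theorem leftFace_rightFace_up {x y s t : Site 2} (hadj : hexGraph.Adj (x, 0) (y, 1))
    (hs : s ∈ hexFaceVertices (x, 0)) (hs' : s ∈ hexFaceVertices (y, 1))
    (ht : t ∈ hexFaceVertices (x, 0)) (ht' : t ∈ hexFaceVertices (y, 1)) (hst : s ≠ t) :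
    (HV.leftFace (toHV (x, 0)) (toHV (y, 1)) = (s 0, s 1) ∧
        HV.rightFace (toHV (x, 0)) (toHV (y, 1)) = (t 0, t 1)) ∨
      (HV.leftFace (toHV (x, 0)) (toHV (y, 1)) = (t 0, t 1) ∧
        HV.rightFace (toHV (x, 0)) (toHV (y, 1)) = (s 0, s 1)) := by
  rcases (hexGraph_adj_iff_of_snd_eq_zero_holds x y).1 hadj with rfl | rfl | rfl
  · rcases mem_inter_up_down hs hs' with rfl | rfl <;>
      rcases mem_inter_up_down ht ht' with rfl | rfl
    · exact absurd rfl hst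
    · right; simp [toHV]
    · left; simp [toHV]
    · exact absurd rfl hst
  · rcases mem_inter_up_left hs hs' with rfl | rfl <;>
      rcases mem_inter_up_left ht ht' with rfl | rfl
    · exact absurd rfl hst
    · left; simp [toHV]
    · right; simp [toHV]
    · exact absurd rfl hst
  · rcases mem_inter_up_bottom hs hs' with rfl | rfl <;>
      rcases mem_inter_up_bottom ht ht' with rfl | rfl
    · exact absurd rfl hst
    · right; simp [toHV]
    · left; simp [toHV]
    · exact absurd rfl hst

/-- **The two hexagons at a dual dart.** For adjacent faces `f ∼ g` of `𝕋` (an edge of `ℍ`) and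
the two distinct common vertices `s`, `t` of the two triangles (the dual `𝕋`-edge), the faces of
`ℍ` to the left and to the right of the dart `f → g` in the coordinate model `HV` are the hexagons
centred at `s` and `t`, in some order. [folklore] -/
theorem leftFace_rightFace {f g : HexVertex} {s t : Site 2} (hadj : hexGraph.Adj f g)
    (hs : s ∈ hexFaceVertices f) (hs' : s ∈ hexFaceVertices g)
    (ht : t ∈ hexFaceVertices f) (ht' : t ∈ hexFaceVertices g) (hst : s ≠ t) :
    (HV.leftFace (toHV f) (toHV g) = (s 0, s 1) ∧ HV.rightFace (toHV f) (toHV g) = (t 0, t 1)) ∨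
      (HV.leftFace (toHV f) (toHV g) = (t 0, t 1) ∧
        HV.rightFace (toHV f) (toHV g) = (s 0, s 1)) := by
  obtain ⟨x, k⟩ := f
  obtain ⟨y, l⟩ := g
  fin_cases k <;> fin_cases l
  · exact absurd hadj (not_hexGraph_adj_of_snd_eq_holds _ _ rfl)
  · exact leftFace_rightFace_up hadj hs hs' ht ht' hst
  · have h := leftFace_rightFace_up hadj.symm hs' hs ht' ht hst
    simp only [HV.rightFace] at h ⊢
    tauto
  · exact absurd hadj (not_hexGraph_adj_of_snd_eq_holds _ _ rfl)

/-- **Two distinct vertices of a face span a dual edge**: if `s ≠ t` are vertices of the face `f`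
of `𝕋`, some neighbour `g` of `f` in `ℍ` also contains both (the `𝕋`-edge `{s, t}` separates `f`
from `g`). [folklore] -/
theorem exists_adj_of_mem_mem {f : HexVertex} {s t : Site 2} (hs : s ∈ hexFaceVertices f)
    (ht : t ∈ hexFaceVertices f) (hst : s ≠ t) :
    ∃ g : HexVertex, hexGraph.Adj f g ∧ s ∈ hexFaceVertices g ∧ t ∈ hexFaceVertices g := by
  obtain ⟨x, k⟩ := f
  fin_cases k
  · simp only [Fin.zero_eta] at hs ht ⊢
    have hA : ∀ y : Site 2, (y = x ∨ y = x - Pi.single 0 1 ∨ y = x - Pi.single 1 1) →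
        s ∈ hexFaceVertices (y, 1) → t ∈ hexFaceVertices (y, 1) →
        ∃ g : HexVertex, hexGraph.Adj (x, 0) g ∧ s ∈ hexFaceVertices g ∧ t ∈ hexFaceVertices g :=
      fun y hy h1 h2 => ⟨(y, 1), (hexGraph_adj_iff_of_snd_eq_zero_holds x y).2 hy, h1, h2⟩
    rw [mem_hexFaceVertices_zero] at hs ht
    rcases hs with rfl | rfl | rfl <;> rcases ht with rfl | rfl | rfl
    · exact absurd rfl hst
    · refine hA _ (Or.inr (Or.inr rfl)) ?_ ?_ <;>
        simp only [mem_hexFaceVertices_one, site_two_eq_iff, Pi.add_apply, Pi.sub_apply,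
          Pi.single_apply] <;> simp
    · refine hA _ (Or.inr (Or.inl rfl)) ?_ ?_ <;>
        simp only [mem_hexFaceVertices_one, site_two_eq_iff, Pi.add_apply, Pi.sub_apply,
          Pi.single_apply] <;> simp
    · refine hA _ (Or.inr (Or.inr rfl)) ?_ ?_ <;>
        simp only [mem_hexFaceVertices_one, site_two_eq_iff, Pi.add_apply, Pi.sub_apply,
          Pi.single_apply] <;> simp
    · exact absurd rfl hst
    · refine hA _ (Or.inl rfl) ?_ ?_ <;>
        simp only [mem_hexFaceVertices_one, site_two_eq_iff, Pi.add_apply, Pi.single_apply] <;>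
        simp
    · refine hA _ (Or.inr (Or.inl rfl)) ?_ ?_ <;>
        simp only [mem_hexFaceVertices_one, site_two_eq_iff, Pi.add_apply, Pi.sub_apply,
          Pi.single_apply] <;> simp
    · refine hA _ (Or.inl rfl) ?_ ?_ <;>
        simp only [mem_hexFaceVertices_one, site_two_eq_iff, Pi.add_apply, Pi.single_apply] <;>
        simp
    · exact absurd rfl hst
  · simp only [Fin.mk_one] at hs ht ⊢
    have hA : ∀ y : Site 2, (y = x ∨ y = x + Pi.single 0 1 ∨ y = x + Pi.single 1 1) →
        s ∈ hexFaceVertices (y, 0) → t ∈ hexFaceVertices (y, 0) →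
        ∃ g : HexVertex, hexGraph.Adj (x, 1) g ∧ s ∈ hexFaceVertices g ∧ t ∈ hexFaceVertices g :=
      fun y hy h1 h2 => ⟨(y, 0), (hexGraph_adj_iff_of_snd_eq_one x y).2 hy, h1, h2⟩
    rw [mem_hexFaceVertices_one] at hs ht
    rcases hs with rfl | rfl | rfl <;> rcases ht with rfl | rfl | rfl
    · exact absurd rfl hst
    · refine hA _ (Or.inl rfl) ?_ ?_ <;>
        simp only [mem_hexFaceVertices_zero, site_two_eq_iff, Pi.add_apply, Pi.single_apply] <;>
        simp
    · refine hA _ (Or.inr (Or.inl rfl)) ?_ ?_ <;>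
        simp only [mem_hexFaceVertices_zero, site_two_eq_iff, Pi.add_apply, Pi.single_apply] <;>
        simp
    · refine hA _ (Or.inl rfl) ?_ ?_ <;>
        simp only [mem_hexFaceVertices_zero, site_two_eq_iff, Pi.add_apply, Pi.single_apply] <;>
        simp
    · exact absurd rfl hst
    · refine hA _ (Or.inr (Or.inr rfl)) ?_ ?_ <;>
        simp only [mem_hexFaceVertices_zero, site_two_eq_iff, Pi.add_apply, Pi.single_apply] <;>
        simp
    · refine hA _ (Or.inr (Or.inl rfl)) ?_ ?_ <;>
        simp only [mem_hexFaceVertices_zero, site_two_eq_iff, Pi.add_apply, Pi.single_apply] <;>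
        simp
    · refine hA _ (Or.inr (Or.inr rfl)) ?_ ?_ <;>
        simp only [mem_hexFaceVertices_zero, site_two_eq_iff, Pi.add_apply, Pi.single_apply] <;>
        simp
    · exact absurd rfl hst

/-! ### The obstruction: no chain around a boundary vertex with two outer neighbours -/

/-- **Topological input for the discrete Poincaré lemma.** Let the complement of `Λ` be
connected in `ℍ` (`hexDomainSimplyConnected`), let `v ∈ Λ` have two distinct neighbours
`w, w' ∉ Λ`, and let `{s, t}` be the `𝕋`-edge between `v` and `w`.  Then there is no chain
`s = p₀, p₁, …, pₙ = t` of vertices of `𝕋` with consecutive ones on a common face of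
`Λ ∖ {v}`.  Proof: a path from `w` to `w'` inside `Λᶜ` closes up through `v` to a simple cycle `l`
of `ℍ`; its winding number around hexagons (`HV.wnd`, `HexSAWWinding.lean`) is constant along such
a chain (the dual edges of its steps are edges of faces of `Λ ∖ {v}`, which are off the cycle, so
they carry no flux: `HV.wnd_left_sub_right`), whereas it jumps by `1` between `s` and `t` (the dart
`v → w` lies on the cycle, `HV.IsCyc.flux_eq_one`). [folklore] -/
theorem not_reflTransGen_of_two_outer_nbrs {Λ : Finset HexVertex}
    (hΛ : hexDomainSimplyConnected Λ) {v w w' : HexVertex} (hv : v ∈ Λ) (hw : w ∉ Λ)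
    (hw' : w' ∉ Λ) (hww' : w ≠ w') (hvw : hexGraph.Adj v w) (hvw' : hexGraph.Adj v w')
    {s t : Site 2} (hs : s ∈ hexFaceVertices v) (hs' : s ∈ hexFaceVertices w)
    (ht : t ∈ hexFaceVertices v) (ht' : t ∈ hexFaceVertices w) (hst : s ≠ t) :
    ¬ Relation.ReflTransGen
        (fun p q : Site 2 => ∃ f ∈ Λ.erase v, p ∈ hexFaceVertices f ∧ q ∈ hexFaceVertices f)
        s t := by
  classical
  intro hreach
  -- a simple path from `w` to `w'` in the complement of `Λ`
  obtain ⟨P⟩ := hΛ ⟨w, by simpa using hw⟩ ⟨w', by simpa using hw'⟩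
  set Q := P.bypass with hQ
  have hQp : Q.IsPath := P.bypass_isPath
  set M : List HV := Q.support.tail.map fun z => toHV z.1 with hM
  have hsupp : Q.support.map (fun z => toHV z.1) = toHV w :: M := by
    rw [hM]
    nth_rw 1 [← Q.cons_tail_support]
    rfl
  -- the cycle `v, w, …, w'`
  set l : List HV := toHV v :: toHV w :: M with hl
  have htoHV : Function.Injective toHV := fun a b h => by
    simpa using congrArg ofHV h
  have hmemM : ∀ z ∈ toHV w :: M, ∃ u : HexVertex, u ∉ Λ ∧ toHV u = z := by
    intro z hz
    rw [← hsupp, List.mem_map] at hz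
    obtain ⟨u, -, rfl⟩ := hz
    have hu := u.2
    rw [Set.mem_compl_iff, Finset.mem_coe] at hu
    exact ⟨u.1, hu, rfl⟩
  have hchain : (toHV w :: M).IsChain hvGraph.Adj := by
    rw [← hsupp, List.isChain_map]
    exact List.IsChain.imp (fun a b h => (hexGraph_adj_iff_hvGraph_adj _ _).1 h)
      Q.isChain_adj_support
  have hlast : (toHV w :: M).getLast (List.cons_ne_nil _ _) = toHV w' := by
    simp only [← hsupp, List.getLast_map, Q.getLast_support]
  have hadj : ∀ d ∈ HV.cdarts l, hvGraph.Adj d.1 d.2 := by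
    intro d hd
    rw [hl, HV.cdarts_cons_cons, List.mem_append, List.mem_cons, List.mem_singleton] at hd
    rcases hd with (rfl | hd) | rfl
    · exact (hexGraph_adj_iff_hvGraph_adj _ _).1 hvw
    · exact HV.adj_of_mem_pdarts hchain d hd
    · rw [hlast]
      exact (hexGraph_adj_iff_hvGraph_adj _ _).1 hvw'.symm
  have hvl : ∀ u ∈ Λ, toHV u ∉ toHV w :: M := by
    intro u hu hmem
    obtain ⟨u', hu', he⟩ := hmemM _ hmem
    exact hu' (htoHV he ▸ hu)
  have hcyc : HV.IsCyc l := by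
    refine ⟨?_, ?_, hadj⟩
    · -- length: the path has at least one edge since `w ≠ w'`
      rw [hl, List.length_cons, List.length_cons, hM, List.length_map, List.length_tail,
        SimpleGraph.Walk.length_support]
      have : Q.length ≠ 0 := fun h0 => hww' (by
        have := SimpleGraph.Walk.eq_of_length_eq_zero h0
        simpa using congrArg Subtype.val this)
      omega
    · rw [hl, List.nodup_cons]
      refine ⟨hvl v hv, ?_⟩
      rw [← hsupp]
      exact hQp.support_nodup.map (htoHV.comp Subtype.val_injective)
  -- the winding number of `l` around the hexagon centred at a vertex of `𝕋`
  set W : Site 2 → ℤ := fun p => HV.wnd l (p 0, p 1) with hW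
  -- it is constant along the chain
  have hstep : ∀ p q : Site 2,
      (∃ f ∈ Λ.erase v, p ∈ hexFaceVertices f ∧ q ∈ hexFaceVertices f) → W p = W q := by
    rintro p q ⟨f, hf, hp, hq⟩
    by_cases hpq : p = q
    · rw [hpq]
    obtain ⟨g, hfg, hp', hq'⟩ := exists_adj_of_mem_mem hp hq hpq
    have hfl : toHV f ∉ l := by
      rw [hl, List.mem_cons, not_or]
      exact ⟨fun h => (Finset.mem_erase.1 hf).1 (htoHV h), hvl f (Finset.mem_erase.1 hf).2⟩
    have h0 := HV.wnd_left_eq_right hadj ((hexGraph_adj_iff_hvGraph_adj _ _).1 hfg)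
      (HV.flux_eq_zero_of_not_mem (Or.inl hfl))
    rcases leftFace_rightFace hfg hp hp' hq hq' hpq with ⟨h1, h2⟩ | ⟨h1, h2⟩
    · rw [h1, h2] at h0; exact h0
    · rw [h1, h2] at h0; exact h0.symm
  have hconst : ∀ q, Relation.ReflTransGen
      (fun p q : Site 2 => ∃ f ∈ Λ.erase v, p ∈ hexFaceVertices f ∧ q ∈ hexFaceVertices f) s q →
      W s = W q := by
    intro q hq
    induction hq with
    | refl => rfl
    | tail _ hpq ih => exact ih.trans (hstep _ _ hpq)
  replace hconst := hconst t hreach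
  -- but it jumps across the dart `v → w`
  have hmem : (toHV v, toHV w) ∈ HV.cdarts l := by
    rw [hl, HV.cdarts_cons_cons]
    exact List.mem_cons_self
  have hjump := HV.wnd_left_sub_right hadj ((hexGraph_adj_iff_hvGraph_adj _ _).1 hvw)
  rw [hcyc.flux_eq_one hmem] at hjump
  rcases leftFace_rightFace hvw hs hs' ht ht' hst with ⟨h1, h2⟩ | ⟨h1, h2⟩
  · rw [h1, h2] at hjump
    change W s - W t = 1 at hjump
    omega
  · rw [h1, h2] at hjump
    change W t - W s = 1 at hjump
    omega

end Summit.CriticalPhenomena.SAWScalingLimit.Theorems.PotentialExists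

end
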